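import Literature.AlgebraicGeometry.Motives.EllAdicTowerRational
import Literature.AlgebraicGeometry.Motives.EtaleModCohomologyPoint
import HarnessLib

/-!
# The `ℓ`-adic cohomology of a geometric point vanishes in positive degrees

For `K` separably closed, `EtaleModCohomologyPoint.lean` gives `Hⁿ((Spec K)_ét, R) = 0` for
`n ≥ 1` and every ring `R`. Passing to the `ℓ`-adic tower (`LinearCohomologyEllAdicTower.lean`)
and to `ℚ_ℓ` (`EllAdicTowerRational.lean`):

* `subsingleton_etaleEllAdicTowerCohomology_point`: `lim_m Hⁿ((Spec K)_ét, ℤ/ℓᵐ) = 0` for `n ≥ 1`;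
* `subsingleton_etaleEllAdicRat_point`, `etaleEllAdicRat_point_eq_zero`:
  **`Hⁿ((Spec K)_ét, ℚ_ℓ) = 0` for `n ≥ 1`** — the case `X = Spec k`, `X_{k̄} = Spec k̄`, `dim X = 0`
  of the vanishing `Hⁱ = 0` for `i > 2 dim X` of a Weil cohomology (Kleiman 1968 §1.2 (A);
  Milne III Example 1.7 (a) with `G = 1`).

## References

* J. S. Milne, *Étale cohomology* (reissue 2025; `book:milne2025-etale-cohomology`): III
  Example 1.7 (a) (PDF p. 95), V §1 (p. 176). [Milne2025]
-/

universe u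

open CategoryTheory CategoryTheory.Limits AlgebraicGeometry Opposite
open scoped TensorProduct

namespace Literature.AlgebraicGeometry.Motives

variable (K : Type u) [Field K] [IsSepClosed K] (ℓ : ℕ) [Fact ℓ.Prime] (n : ℕ)

/-- **`lim_m Hⁿ((Spec K)_ét, ℤ/ℓᵐ) = 0` for `n ≥ 1`** (`K` separably closed): every level vanishes
(`subsingleton_etaleModCohomology_point`). [cite: Milne2025, III Example 1.7 (a)] -/
instance subsingleton_etaleEllAdicTowerCohomology_point :
    Subsingleton (etaleEllAdicTowerCohomology (Spec (CommRingCat.of K)) ℓ (n + 1)) := by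
  haveI : ∀ m, Subsingleton (etaleZModPowCohomology (Spec (CommRingCat.of K)) ℓ m (n + 1)) :=
    fun m => subsingleton_etaleModCohomology_point K (ZModPow.{u} ℓ m) n
  infer_instance

/-- **`Hⁿ((Spec K)_ét, ℚ_ℓ) = 0` for `n ≥ 1`** (`K` separably closed): `ℚ_ℓ ⊗_{ℤ_ℓ} 0 = 0`. The
case `dim = 0` of the vanishing of a Weil cohomology above twice the dimension.
(Mathlib: a tensor product with a trivial module is trivial.) [cite: Milne2025, III Example 1.7 (a)] -/
instance subsingleton_etaleEllAdicRat_point :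
    Subsingleton (etaleEllAdicRat ℓ (Spec (CommRingCat.of K)) (n + 1)) :=
  inferInstance

/-- `Hⁿ((Spec K)_ét, ℚ_ℓ) ∋ x = 0` for `n ≥ 1`. [folklore] -/
theorem etaleEllAdicRat_point_eq_zero (x : etaleEllAdicRat ℓ (Spec (CommRingCat.of K)) (n + 1)) :
    x = 0 :=
  Subsingleton.elim _ _

end Literature.AlgebraicGeometry.Motives
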